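import Summits.CriticalPhenomena.PercolationContinuityZ3.Theorems.Transplant.FKThreeApexHarmCap
import Summits.CriticalPhenomena.PercolationContinuityZ3.Theorems.Transplant.FKThreeApexT3EnvelopeHarmTop
import Summits.CriticalPhenomena.PercolationContinuityZ3.Theorems.Transplant.FKThreeApexNegCorrT3OfEnvelope
import Summits.CriticalPhenomena.PercolationContinuityZ3.Theorems.Transplant.FKConnectivityAllQWheelRayleigh
import HarnessLib

/-!
# The three-apex monoid: (A), type T3 and ALL PAIRS of the weighted `K_{1,1,1,n}` for EVERY `0 < q ≤ 1`

Support file (`--supports stmt-CriticalPhenomena-4575`), FK sub-lane `prim-bschramm-fk-3` (gen 18); builds on p205010 (kernel theorem,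
internal audit signed; external expert review pending).  No named facts, no sorries; standard axioms.  Memo
`bschramm/prim-bschramm-fk-3/T3-HARMONIC.md`.

The envelope statement `(A) = EnvelopeA q` (file `…T3Envelope`) — non-negativity of the frontier form `vForm q θ θ' Z` on the
three-apex monoid — was a kernel theorem for `q ∈ [1/4, 1]` (`…T3EnvelopeQuarter`, four LP certificates) and open below `1/4`.
This file proves it for EVERY `0 < q ≤ 1` by a different, uniform route:

* the frontier form is affine along the `Z₁`-fibre and `≥ 0` at its lower end (`…T3EnvelopeFibre`);
* at the upper end allowed by the **harmonic cap** `v̂ û³ e₂ ≤ x̂ŷẑ(û e₂ + q e₃)` of the monoid (`InK.harmCap_nonneg`, file `…HarmCap`)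
  its value is the polynomial `clTop`, non-negative on the whole orthant by the explicit SOS certificate `clTop_nonneg`
  (file `…T3EnvelopeHarmTop`);
* degenerate fibres (`e₂ = 0`) have `Z₁ = 0` by the caps.

Consequences: **`envelopeA_allQ`**, type T3 on the monoid for all leaf probabilities (`InK.t3Form_nonneg_allQ`), and at the measure
level (via `…NegCorrT3OfEnvelope`): the T3 pairs (`negCorrTri_T3_allQ`) and **every pair of edges of every weighted `K_{1,1,1,n}`
(`negCorrTri_allPairs_allQ`) are negatively correlated under `φ_{w,q}` for every `0 < q ≤ 1`** — with the earlier files of the lineage,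
every graph with a vertex cover of size `≤ 3` is Potts–Rayleigh on `(0, 1]`.
[cite: Grimmett2006, §3.9 eq. (3.94), Conj. (3.96) (pp. 63–66)] [cite: Wagner2006, Conj. 5.3 (p. 13)]
-/

noncomputable section

namespace Summit.CriticalPhenomena.PercolationContinuityZ3.Theorems

namespace FK

namespace ThreeApex

/-! ### The two ends of the fibre -/

/-- At `Z₀ = 0` the `Z₁`-slope of the frontier form is non-negative (all its coefficients are then `≥ 0`). [folklore] -/
theorem vSlope_nonneg_of_z0_zero {q t s a b c z1 : ℝ} (hq0 : 0 ≤ q) (ht : 0 ≤ t) (hs : 0 ≤ s) (ha : 0 ≤ a) (hb : 0 ≤ b)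
    (hc : 0 ≤ c) : 0 ≤ vSlope q t s ⟨0, a, b, c, z1⟩ := by
  have e : vSlope q t s ⟨0, a, b, c, z1⟩ = a + s * (q * (a + c)) + s ^ 2 * c + t * (q * (a + b))
      + t * s * (2 * q * (b + c) + q ^ 2 * (a + b + c)) + t * s ^ 2 * (2 * c + q * (b + c))
      + t ^ 2 * b + t ^ 2 * s * (2 * b + q * (b + c)) + t ^ 2 * s ^ 2 * (b + c) := by
    simp only [vSlope, hx, hy, hz]; ring
  rw [e]; positivity

/-- The lower end of the fibre, both orderings of `Z_ac, Z_bc`: `vForm q θ θ' (dropTop Z) ≥ 0` for non-negative masses. [folklore] -/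
theorem vForm_dropTop_nonneg {q t s : ℝ} (hq0 : 0 ≤ q) (hq1 : q ≤ 1) (ht : 0 ≤ t) (hs : 0 ≤ s) {Z : V5} (hZ : Z.Nonneg) :
    0 ≤ vForm q t s (dropTop Z) := by
  rcases le_total Z.zac Z.zbc with hle | hle
  · exact vForm_z1_zero_nonneg hq0 hq1 ht hs hZ.h0 hZ.hab hZ.hac hle
  · have e : dropTop Z = swapAB (dropTop (swapAB Z)) := by simp only [dropTop, swapAB]
    rw [e, ← vForm_swapAB]
    exact vForm_z1_zero_nonneg hq0 hq1 hs ht hZ.h0 hZ.hab hZ.hbc hle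

/-- On a degenerate fibre (`e₂ = 0`, `Z₀ > 0`) the caps force `Z₁ = 0`. [folklore] -/
theorem z1_eq_zero_of_hE2_zero {q : ℝ} {Z : V5} (hN : Z.Nonneg) (hu : 0 < Z.z0) (hA : 0 ≤ capA q Z) (hB : 0 ≤ capB q Z)
    (he : hE2 Z.zab Z.zac Z.zbc = 0) : Z.z1 = 0 := by
  have hbc : Z.zac * Z.zbc = 0 := by
    unfold hE2 at he
    nlinarith [mul_nonneg hN.hab hN.hac, mul_nonneg hN.hab hN.hbc, mul_nonneg hN.hac hN.hbc]
  rcases hE2_eq_zero hN.hab hN.hac hN.hbc he with h0 | ⟨h1, h2⟩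
  · -- `Z_ab = 0`: `capA = Z₀²(ŷẑ − v̂ Z₀) ≥ 0` and `ŷẑ − v̂Z₀ = Z_acZ_bc − Z₀Z₁`
    have e : capA q Z = Z.z0 ^ 2 * (Z.zac * Z.zbc - Z.z0 * Z.z1) := by
      simp only [capA, hx, hy, hz, V5.total, h0]; ring
    have h3 : 0 ≤ Z.zac * Z.zbc - Z.z0 * Z.z1 := by
      rw [e] at hA; exact le_of_mul_le_mul_left (by simpa using hA) (pow_pos hu 2)
    nlinarith [mul_nonneg hu.le hN.h1, hN.h1, hu]
  · have e : capB q Z = -(Z.z0 ^ 2 * (Z.z0 * (Z.zab + Z.z1)) - Z.z0 ^ 2 * (Z.z0 * Z.zab)) := by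
      simp only [capB, hx, hy, hz, V5.total, h1, h2]; ring
    have h3 : Z.z0 ^ 3 * Z.z1 ≤ 0 := by rw [e] at hB; nlinarith [hB]
    have h4 : 0 ≤ Z.z0 ^ 3 * Z.z1 := mul_nonneg (pow_nonneg hu.le 3) hN.h1
    have h5 : Z.z0 ^ 3 * Z.z1 = 0 := le_antisymm h3 h4
    rcases mul_eq_zero.1 h5 with h | h
    · exact absurd h (pow_ne_zero 3 hu.ne')
    · exact h

/-! ### The frontier form from the harmonic cap -/

/-- **Pointwise core**: for non-negative masses, the caps `capA, capB ≥ 0` and the harmonic cap `harmCap ≥ 0` imply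
`vForm q θ θ' Z ≥ 0` (`0 ≤ q ≤ 1`, `θ, θ' ≥ 0`). [folklore] -/
theorem vForm_nonneg_of_harmCap {q t s : ℝ} (hq0 : 0 ≤ q) (hq1 : q ≤ 1) (ht : 0 ≤ t) (hs : 0 ≤ s) {Z : V5} (hZ : Z.Nonneg)
    (hA : 0 ≤ capA q Z) (hB : 0 ≤ capB q Z) (hH : 0 ≤ harmCap q Z) : 0 ≤ vForm q t s Z := by
  rcases le_or_gt 0 (vSlope q t s Z) with hsl | hsl
  · exact vForm_nonneg_of_vSlope_nonneg' hq0 hq1 ht hs hZ hsl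
  obtain ⟨h0, h1, h2, h3, h4⟩ := hZ
  rcases Z with ⟨u, a, b, c, z1⟩
  simp only at h0 h1 h2 h3 h4 hsl hA hB hH ⊢
  -- `Z₀ > 0` (else the slope is `≥ 0`)
  rcases eq_or_lt_of_le h0 with hu | hu
  · exfalso
    rw [← hu] at hsl
    exact absurd (vSlope_nonneg_of_z0_zero (z1 := z1) hq0 ht hs h1 h2 h3) (not_le.mpr hsl)
  -- degenerate fibre: `Z₁ = 0`, the point is the lower end
  rcases eq_or_lt_of_le (hE2_nonneg h1 h2 h3) with he | he
  · have hz1 : z1 = 0 := z1_eq_zero_of_hE2_zero (Z := ⟨u, a, b, c, z1⟩) ⟨h0, h1, h2, h3, h4⟩ hu hA hB he.symm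
    have : (⟨u, a, b, c, z1⟩ : V5) = dropTop ⟨u, a, b, c, z1⟩ := by simp only [dropTop, hz1]
    rw [this]
    exact vForm_dropTop_nonneg hq0 hq1 ht hs ⟨h0, h1, h2, h3, h4⟩
  -- generic fibre: compare with the harmonic top
  have hlow : 0 ≤ vForm q t s ⟨u, a, b, c, 0⟩ := vForm_dropTop_nonneg (Z := ⟨u, a, b, c, z1⟩) hq0 hq1 ht hs ⟨h0, h1, h2, h3, h4⟩
  have haff : vForm q t s ⟨u, a, b, c, z1⟩ = vForm q t s ⟨u, a, b, c, 0⟩ + z1 * vSlope q t s ⟨u, a, b, c, z1⟩ :=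
    vForm_eq_affine q t s ⟨u, a, b, c, z1⟩
  have hslope0 : vSlope q t s ⟨u, a, b, c, z1⟩ = vSlope q t s ⟨u, a, b, c, 0⟩ := by simp only [vSlope, hx, hy, hz]
  -- the harmonic cap as a bound on `Z₁`
  have hcap : (u + a + b + c + z1) * u ^ 3 * hE2 a b c ≤ (u + a) * (u + b) * (u + c) * (u * hE2 a b c + q * hE3 a b c) := by
    have := hH; unfold harmCap harmPhi at this; simp only [hx, hy, hz, V5.total] at this; linarith
  have hz1 : z1 * (u ^ 3 * hE2 a b c)
      ≤ (u + a) * (u + b) * (u + c) * (u * (a * b + a * c + b * c) + q * (a * b * c)) - u ^ 3 * (a * b + a * c + b * c) * (u + a + b + c) := by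
    simp only [hE2, hE3] at hcap ⊢; nlinarith [hcap]
  have htop := clTop_nonneg (q := q) (t := t) (s := s) hu h1 h2 h3 ht hs hq0
  unfold clTop at htop
  have hpos : 0 < u ^ 3 * hE2 a b c := mul_pos (pow_pos hu 3) he
  -- `u³e₂ · V(Z) ≥ clTop ≥ 0`
  have key : u ^ 3 * hE2 a b c * vForm q t s ⟨u, a, b, c, z1⟩ ≥
      u ^ 3 * (a * b + a * c + b * c) * vForm q t s ⟨u, a, b, c, 0⟩
        + ((u + a) * (u + b) * (u + c) * (u * (a * b + a * c + b * c) + q * (a * b * c))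
            - u ^ 3 * (a * b + a * c + b * c) * (u + a + b + c)) * vSlope q t s ⟨u, a, b, c, 0⟩ := by
    rw [haff, hslope0, mul_add]
    have e1 : u ^ 3 * hE2 a b c * vForm q t s ⟨u, a, b, c, 0⟩ = u ^ 3 * (a * b + a * c + b * c) * vForm q t s ⟨u, a, b, c, 0⟩ := by
      unfold hE2; ring
    have e2 : u ^ 3 * hE2 a b c * (z1 * vSlope q t s ⟨u, a, b, c, 0⟩) = (z1 * (u ^ 3 * hE2 a b c)) * vSlope q t s ⟨u, a, b, c, 0⟩ := by
      ring
    rw [e1, e2]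
    have hsl' : vSlope q t s ⟨u, a, b, c, 0⟩ < 0 := by rw [← hslope0]; exact hsl
    nlinarith [mul_le_mul_of_nonpos_right hz1 hsl'.le]
  nlinarith [key, htop, hpos]

/-- **(A) FOR EVERY `0 < q ≤ 1`.** [folklore] -/
theorem envelopeA_allQ {q : ℝ} (hq0 : 0 < q) (hq1 : q ≤ 1) : EnvelopeA q := by
  intro θ θ' hθ hθ' Z hZ
  exact vForm_nonneg_of_harmCap hq0.le hq1 hθ hθ' (hZ.nonneg hq0.le) (hZ.capA_nonneg hq0.le hq1) (hZ.capB_nonneg hq0.le hq1)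
    (hZ.harmCap_nonneg hq0.le hq1)

/-- **Type T3 for every `0 < q ≤ 1`**: the T3 Rayleigh form is non-negative for all leaf probabilities and every rest in the monoid. [folklore] -/
theorem InK.t3Form_nonneg_allQ {q : ℝ} (hq0 : 0 < q) (hq1 : q ≤ 1) {b₁ c₁ a₂ c₂ : ℝ}
    (hb0 : 0 ≤ b₁) (hb1 : b₁ ≤ 1) (hc0 : 0 ≤ c₁) (hc1 : c₁ ≤ 1) (ha0 : 0 ≤ a₂) (ha1 : a₂ ≤ 1) (hd0 : 0 ≤ c₂) (hd1 : c₂ ≤ 1)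
    {R : V5} (hR : InK q R) : 0 ≤ t3Form q b₁ c₁ a₂ c₂ R :=
  hR.t3Form_nonneg_of_envelopeA hq0 hq1 (envelopeA_allQ hq0 hq1) hb0 hb1 hc0 hc1 ha0 ha1 hd0 hd1

/-! ### Measure level -/

section Setting

open Literature.Probability.LatticeModels Literature.Probability.Percolation
open scoped Classical

variable {V : Type*} [Fintype V]
variable {a b c : V} {v : ℕ → V} {n : ℕ}
variable (hab : a ≠ b) (hac : a ≠ c) (hbc : b ≠ c) (hinj : ∀ j k, j < n → k < n → v j = v k → j = k)
  (hva : ∀ j, j < n → v j ≠ a) (hvb : ∀ j, j < n → v j ≠ b) (hvc : ∀ j, j < n → v j ≠ c)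
include hab hac hbc hinj hva hvb hvc

/-- **T3 in `K_{1,1,1,n}` for every `0 < q ≤ 1`**: for distinct apices `x ≠ y` and distinct leaves `j₁ ≠ j₂` the leaf edges
`s(x, v j₁)`, `s(y, v j₂)` are negatively correlated under `φ_{w,q}` for arbitrary weights on the full pattern.
(transcription of bschramm/prim-bschramm-fk-3/T3-HARMONIC.md) -/
theorem negCorrTri_T3_allQ {q : ℝ} (hq0 : 0 < q) (hq1 : q ≤ 1) (hcard : Fintype.card V = n + 3) (w : Sym2 V → unitInterval)
    (hsupp : ∀ e, e ∉ fullPairs a b c v n → w e = 0) {j₁ j₂ : ℕ} (hj₁ : j₁ < n) (hj₂ : j₂ < n) (hne : j₁ ≠ j₂) {x y : V}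
    (hx : x = a ∨ x = b ∨ x = c) (hy : y = a ∨ y = b ∨ y = c) (hxy : x ≠ y) :
    (rcMeasureW w q ∅).real ({ω : BondConfig V | s(x, v j₁) ∈ ω} ∩ {ω | s(y, v j₂) ∈ ω}) ≤
      (rcMeasureW w q ∅).real {ω : BondConfig V | s(x, v j₁) ∈ ω} * (rcMeasureW w q ∅).real {ω : BondConfig V | s(y, v j₂) ∈ ω} :=
  negCorrTri_T3_of_envelopeA hab hac hbc hinj hva hvb hvc hq0 hq1 (envelopeA_allQ hq0 hq1) hcard w hsupp hj₁ hj₂ hne hx hy hxy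

/-- **EVERY PAIR OF EDGES OF THE WEIGHTED `K_{1,1,1,n}` IS NEGATIVELY CORRELATED, for every `n`, all weights in `[0,1]` and every
`0 < q ≤ 1`** (with deletion of weight-zero edges: every graph with a vertex cover of size `≤ 3` is Potts–Rayleigh on `(0,1]`).
(transcription of bschramm/prim-bschramm-fk-3/T3-HARMONIC.md) -/
theorem negCorrTri_allPairs_allQ {q : ℝ} (hq0 : 0 < q) (hq1 : q ≤ 1) (hcard : Fintype.card V = n + 3)
    (w : Sym2 V → unitInterval) (hsupp : ∀ e, e ∉ fullPairs a b c v n → w e = 0) {e f : Sym2 V} (he : e ∈ fullPairs a b c v n)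
    (hf : f ∈ fullPairs a b c v n) (hfe : f ≠ e) :
    (rcMeasureW w q ∅).real ({ω : BondConfig V | e ∈ ω} ∩ {ω | f ∈ ω}) ≤
      (rcMeasureW w q ∅).real {ω : BondConfig V | e ∈ ω} * (rcMeasureW w q ∅).real {ω : BondConfig V | f ∈ ω} :=
  negCorrTri_allPairs_of_envelopeA hab hac hbc hinj hva hvb hvc hq0 hq1 (envelopeA_allQ hq0 hq1) hcard w hsupp he hf hfe

/-- **THE CLASS THEOREM: the weighted `K_{1,1,1,n}` is Potts–Rayleigh for every `0 < q ≤ 1`** — edge-negative association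
`EdgeNegCorrSupp` of `φ_{w,q}` for every weight vector supported on the full three-apex pattern (apex–leaf pairs and the triangle);
with weight-zero edges deleted this covers every finite graph with a vertex cover of size `≤ 3`.
(transcription of bschramm/prim-bschramm-fk-3/T3-HARMONIC.md) -/
theorem edgeNegCorrSupp_threeApex {q : ℝ} (hq0 : 0 < q) (hq1 : q ≤ 1) (hcard : Fintype.card V = n + 3) :
    EdgeNegCorrSupp (↑(fullPairs a b c v n) : Set (Sym2 V)) q := by
  intro w hw e f _ hfe
  have hsupp : ∀ g, g ∉ fullPairs a b c v n → w g = 0 := by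
    intro g hg
    by_contra hne
    refine hg (Finset.mem_coe.1 (hw g ?_))
    intro h0
    exact hne (Subtype.ext (by simpa using h0))
  by_cases he0 : ((w e : unitInterval) : ℝ) = 0
  · exact Wheel.negCorr_of_zero_left w hq0 f he0
  by_cases hf0 : ((w f : unitInterval) : ℝ) = 0
  · exact Wheel.negCorr_of_zero_right w hq0 e hf0
  exact negCorrTri_allPairs_allQ hab hac hbc hinj hva hvb hvc hq0 hq1 hcard w hsupp (Finset.mem_coe.1 (hw e he0))
    (Finset.mem_coe.1 (hw f hf0)) hfe

end Setting

end ThreeApex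

end FK

end Summit.CriticalPhenomena.PercolationContinuityZ3.Theorems
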